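import Summits.QuantumFields.BalabanUV.T4Continuum.Support.MinimalActionWitness
import Summits.QuantumFields.BalabanUV.T4Continuum.Support.AveragingDeficitMultiLevelBridge
import HarnessLib

/-!
# T⁴ programme, node NE3, route P2 «ENERGY CONVEXITY» — THE TYPED ROOT `NE3EnergyRate` (NE3 in the energy-distance
# reading, rate `L⁻¹`) over the tree's torus objects, its residual scale `residualScale`, the energy norm, and
# non-vacuity on the flat datum

Eleventh generation of the NE3 prover lineage P2 (unit `b2b-balaban-t4-ne3-p2`, co-owner #2 of `BINDER-OWNERS.md` row
NE3; ROUND-2 SKELETON-FIRST mandate).  This file TYPES the ROOT T-E of the route's skeleton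
`HOME/t4/skeletons/NE3-t4-ne3-p2.md` as a `Prop` over the objects of the owner's action sandwich
(`MinimalActionSandwich.IsMinimiser`, `MinimalActionRate.Regular`, p204506 ∕ p204845) and of row NE3-R2's torus theorems
(`wallConst`, `dualC1`, `dualC2` of `dualResidual_avgIter`, p205109): for the run-A minimiser `U_A` (level `k`) and the
run-B minimiser `U_B` (level `k+1`, `Regular b g`) of the same datum, the block average `W := rescale L (bavg L U_B)`
and `U_A` differ — after a periodic `U(N)` gauge transformation — by a bondwise exponential `U_A^u = W·exp Z` whose
ENERGY NORM `√(curlSq W Z + dirSq Z)` over one period is at most `C · residualScale d L N b g k`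
(`= C·N^{d/2}·O(L^{−k})` for `d = 4`).  It ASSERTS NOTHING: `NE3EnergyRate` is a `def … : Prop` (the statement the
skeleton's leaves imply through `Support/NE3EnergyPath.energyResponse_of_pathData`), proved here ONLY for the flat
datum in the flat class (`ne3EnergyRate_flat`, non-vacuity: both minimisers are flat, `Z = 0`, `u = 1`).

HONEST FRAMING.  Finite-T⁴ bookkeeping (rung (B)+1); no estimate is proved; no conditional of the cell is used or
hidden; NOT infinite volume ∕ mass gap ∕ Clay ∕ summit progress; NE3 is NOT proved.  ABSOLUTE RULE kept: no printed
sentence is a hypothesis; context: [Balaban1985Variational] Thm 1 p. 279, (19)–(21) p. 281, §E (115)–(121) p. 295.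
PLACEMENT: `Summits/QuantumFields/BalabanUV/` (our statements); imports the accepted `Support.MinimalActionWitness`
(p204967) and `Support.AveragingDeficitMultiLevelBridge` (p205109) only; moves nothing.
-/

set_option autoImplicit false

open scoped BigOperators Matrix Matrix.Norms.L2Operator
open NormedSpace Finset

namespace Summit.QuantumFields.BalabanUV.T4Continuum.NE3EnergyShapes

open Literature.MathematicalPhysics.QuantumFieldTheory.Balaban1983to89
open B7Prop1Explicit B7Prop2Explicit MatrixLog UnitaryModel
open T4AveragingDeficitWall hiding Site Plane Plaq Bond
open T4AveragingDeficitWallBoundary (IsPeriodicCfg periodBox)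
open AveragingDeficitPeriodicCounting (IsPeriodicDir)
open AveragingDeficitDerivWallProof (wallConst wallConst_nonneg)
open AveragingDeficitDualResidual (dualC1 dualC2)
open MinimalActionSandwich (IsMinimiser)
open MinimalActionRate (Regular)
open MinimalActionWitness (flatCfg flatClass)

noncomputable section

variable {d : ℕ} {n : Type*} [Fintype n] [DecidableEq n]

local notation "𝕄" => Matrix n n ℂ
local notation "Site" => B7Prop1Explicit.Site

/-! ## §1 The energy norm of a direction at a background, and the residual scale of level `k` -/

/-- THE ENERGY NORM of a direction field `Z` at the background `W` over the site set `F`: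
`√(Σ_{plaquettes}‖(d_W Z)(p)‖² + Σ_{bonds}‖Z(b)‖²)` (the unit-scale form of ML-SUPPLIED's `N(W)² = ‖D_{U₀}W‖² + ⟨W,𝒲W⟩`;
tree `curlSq`, `dirSq`). [folklore] -/
def energyNorm (W : Site d → Fin d → 𝕄ˣ) (Z : Site d → Fin d → 𝕄) (F : Finset (Site d)) : ℝ :=
  Real.sqrt (curlSq W Z F + dirSq Z F)

/-- The energy norm is non-negative. [folklore] -/
theorem energyNorm_nonneg (W : Site d → Fin d → 𝕄ˣ) (Z : Site d → Fin d → 𝕄) (F : Finset (Site d)) :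
    0 ≤ energyNorm W Z F := Real.sqrt_nonneg _

/-- The energy norm of the zero direction vanishes. [folklore] -/
theorem energyNorm_zero (W : Site d → Fin d → 𝕄ˣ) (F : Finset (Site d)) :
    energyNorm W (fun _ _ => 0) F = 0 := by
  unfold energyNorm curlSq dirSq
  simp

/-- THE RESIDUAL SCALE OF LEVEL `k`: the bracket of row NE3-R2's `dualResidual_avgIter` evaluated on the regularity data
`(b, g)` of a level-`(k+1)` `Regular` configuration of the torus of side `N` (`gradFluxSq ≤ g N^d (L^{k+1})^{d−6}`,
`a = b/(L^{k+1})²`) against a direction of `ℓ²`-norm one and `ℓ¹`-norm `√(d·(N L^k)^d)`: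
`L^{4−d}·wallConst·[√(g N^d (L^{k+1})^{d−6})·dualC2 + (b/(L^{k+1})²)²·dualC1·√(d (N L^k)^d)]`.  For `d = 4` this is
`wallConst·N²·L^{−k}·[√g·dualC2/L + 2b²·dualC1·L^{−k−4}]` — rate `L⁻¹` per level. [folklore] -/
def residualScale (d L N : ℕ) (b g : ℝ) (k : ℕ) : ℝ :=
  (L : ℝ) ^ (4 - (d : ℤ)) * wallConst d L *
    (Real.sqrt (g * (N : ℝ) ^ d * ((L : ℝ) ^ (k + 1)) ^ d / ((L : ℝ) ^ (k + 1)) ^ 6) * dualC2 d L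
      + (b / ((L : ℝ) ^ (k + 1)) ^ 2) ^ 2 * dualC1 d L * Real.sqrt (d * ((N * L ^ k : ℕ) : ℝ) ^ d))

/-- `dualC1 ≥ 0`. [folklore] -/
theorem dualC1_nonneg (d L : ℕ) : 0 ≤ dualC1 d L := by unfold dualC1; positivity

/-- `dualC2 ≥ 0`. [folklore] -/
theorem dualC2_nonneg (d L : ℕ) : 0 ≤ dualC2 d L := by unfold dualC2; positivity

/-- The residual scale is non-negative. [folklore] -/
theorem residualScale_nonneg (d L N : ℕ) (b g : ℝ) (k : ℕ) : 0 ≤ residualScale d L N b g k := by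
  unfold residualScale
  have h1 := wallConst_nonneg d L
  have h2 := dualC1_nonneg d L
  have h3 := dualC2_nonneg d L
  positivity

/-! ## §2 The typed ROOT of the route -/

/-- `U(N)`-valued site fields (gauge transformations). [folklore] -/
@[folklore]
def IsUnitarySite (u : Site d → 𝕄ˣ) : Prop := ∀ x, u x ∈ unitaryUnits 𝕄

/-- Periodic site fields. [folklore] -/
@[folklore]
def IsPeriodicSite (u : Site d → 𝕄ˣ) (P : ℤ) : Prop := ∀ (x : Site d) (i : Fin d), u (x + P • e i) = u x

variable (d) in
/-- **ROOT T-E OF THE ENERGY-CONVEXITY ROUTE — NE3 IN THE ENERGY-DISTANCE READING** (a `Prop`; asserted for no class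
here except the flat one below).  For every level `k ≥ 1`, every datum `V ∈ dom`, every run-A minimiser `U_A`
(`IsMinimiser 𝒞 L N k V U_A`) and every run-B minimiser `U_B` (`IsMinimiser 𝒞 L N (k+1) V U_B`) that is
`Regular b g (k+1)`, there are a periodic `U(N)` gauge transformation `u` and a periodic `𝔲(N)` direction `Z` with
`U_A^u = W·exp Z` bondwise, `W := rescale L (bavg L U_B)` (the block average of the finer minimiser read on run A's
lattice), and `energyNorm W Z (one period) ≤ C · residualScale d L N b g k`.  Dictionary (context only, nothing
printed is asserted): B11's representation `U = e^{iηA}U₀` around a background ((19)–(21) p. 281) and the §E solution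
`A₁` (p. 295); the rate itself is NOT printed (cell cross-read T4-XREAD-U1b). A hypothesis∕target SHAPE of ours. [folklore] -/
@[folklore]
def NE3EnergyRate (𝒞 : ℕ → Set (Site d → Fin d → 𝕄ˣ)) (L N : ℕ) (b g C : ℝ)
    (dom : Set (Site d → Fin d → 𝕄ˣ)) : Prop :=
  ∀ k : ℕ, 1 ≤ k → ∀ V ∈ dom, ∀ UA UB : Site d → Fin d → 𝕄ˣ,
    IsMinimiser d 𝒞 L N k V UA → IsMinimiser d 𝒞 L N (k + 1) V UB → Regular d L N b g (k + 1) UB →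
      ∃ (u : Site d → 𝕄ˣ) (Z : Site d → Fin d → 𝕄),
        IsUnitarySite u ∧ IsPeriodicSite u ((N * L ^ k : ℕ) : ℤ) ∧
        IsSkewDir Z ∧ IsPeriodicDir Z ((N * L ^ k : ℕ) : ℤ) ∧
        gaugeAct u UA = vary (rescale L (bavg L UB)) Z 1 ∧
        energyNorm (rescale L (bavg L UB)) Z (periodBox (N * L ^ k)) ≤ C * residualScale d L N b g k

/-! ## §3 Non-vacuity: the flat datum in the flat class -/

/-- The trivial gauge transformation acts trivially. [folklore] -/
theorem gaugeAct_one (V : Site d → Fin d → 𝕄ˣ) : gaugeAct (fun _ => (1 : 𝕄ˣ)) V = V := by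
  funext x μ; simp [gaugeAct]

/-- The block average of the flat configuration, read on the next lattice, is flat. [folklore] -/
theorem rescale_bavg_flatCfg (L : ℕ) : rescale L (bavg L (flatCfg (d := d) (n := n))) = flatCfg := by
  funext z κ
  rw [rescale_apply]
  have h := bavg_flat (d := d) (n := n) L
  unfold flatCfg
  rw [h]

/-- **NON-VACUITY**: in the flat class (`flatClass k = {1}`) with the flat datum, every minimiser of every run is the
flat configuration, and `NE3EnergyRate` holds with `u = 1`, `Z = 0` for every `C ≥ 0` (energy norm `0`). [folklore] -/
theorem ne3EnergyRate_flat [Nonempty n] (L N : ℕ) (b g : ℝ) {C : ℝ} (hC : 0 ≤ C) :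
    NE3EnergyRate d (flatClass (n := n)) L N b g C {flatCfg} := by
  intro k _ V _ UA UB hA hB _
  have hUA : UA = flatCfg := by simpa [flatClass, MinimalActionSandwich.admissible] using hA.mem.1
  have hUB : UB = flatCfg := by simpa [flatClass, MinimalActionSandwich.admissible] using hB.mem.1
  refine ⟨fun _ => 1, fun (_ : Site d) (_ : Fin d) => (0 : 𝕄), fun _ => (unitaryUnits 𝕄).one_mem, fun _ _ => rfl,
    fun _ _ => (skewAdjoint 𝕄).zero_mem, fun _ _ _ => rfl, ?_, ?_⟩
  · rw [hUA, hUB, rescale_bavg_flatCfg, gaugeAct_one, vary_zero_dir]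
  · rw [energyNorm_zero]
    exact mul_nonneg hC (residualScale_nonneg d L N b g k)

end

end Summit.QuantumFields.BalabanUV.T4Continuum.NE3EnergyShapes
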